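import Literature.NumberTheory.EllipticCurves.CanonicalPAdicHeightThetaFormalProofs
import Literature.NumberTheory.EllipticCurves.PadicSigmaSqDivisionTwo
import Mathlib.Algebra.Polynomial.Homogenize
import HarnessLib

/-!
# From the sigma differential equation to the squared division-polynomial identities
# `σ²(nQ) = σ²(Q)^{n²}·F_n²(Q)` (Mazur–Tate 1991, Thm. 3.1 — proofs only)

Trunk T-NT-EC (`Literature/NumberTheory/EllipticCurves`). Pure proof file (no definitions, no named
facts, net literature debt `0`), companion of `PadicSigmaSq.lean` (the sigma-SQUARED receptacle
`IsMazurTateSigmaSqPair`, characterisation by the Mazur–Stein–Tate DIFFERENTIAL EQUATION) and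
`PadicSigmaSqDivisionTwo.lean` (the named fact `mazurTate_sigmaSq_existsUnique_two`, characterisation by
DIVISION POLYNOMIALS as printed by Silverman, Math. Ann. 332 (2005) §5 Rem. 2). Mazur–Tate 1991, Thm. 3.1
asserts that the two characterisations single out the same series; this file proves the direction
«differential equation ⟹ division polynomials» in the tree's vocabulary, for EVERY prime `p`:

* `sigmaSqDivisionIdentity_sq_of_satisfiesSigmaODE` — for a `p`-integral elliptic curve `V/ℚ_p` and ANY
  normalised odd solution `σ = z + ⋯ ∈ ℚ_p⟦z⟧` of the sigma equation `x + c = -D(Dσ/σ)`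
  (`SatisfiesSigmaODE V σ c`; no integrality of `σ` or of `c` is used), the square `Σ = σ²` satisfies
  `V.SigmaSqDivisionIdentity Σ n` for every `n ≥ 1`:
  `z^{2(n²-1)}·Σ([n](z)) = Σ(z)^{n²}·z^{2(n²-1)}ψₙ²(x(z))`.

Typer seat `bsd-goldfeld-ty` g9 of the cell `bsd-goldfeld` (memo `TY-HYPOTHESES-AT-TWO.md` §10.5 row R1b,
referee finding G42/G3b), in support of stmt-BirchSwinnertonDyer-19141 (LTYZ 2025 Thm. 1.1 at `p = 2`):
together with the sequel `SigmaSqDivisionBridgeProofs.lean` it identifies, at a good ordinary `p = 2`,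
the receptacle's `padicSigmaSq` with the printed `σ²` of Silverman's Remark 2.

## The proof (Mazur–Tate's route through the theta relation, as formalised in the tree)

Everything is formal power-series algebra over the domain `ℚ_p⟦z⟧`; the input is the tree's theorem
`thetaLHS_eq_thetaRHS` (Blakestad–Grant 2023, Prop. 14): `σ(u +_F v)σ(u -_F v)u²v² =
(u²X(v) - v²X(u))σ(u)²σ(v)²` in `ℚ_p⟦u, v⟧` (`X = z²x(z)`), valid for every normalised odd solution
of the sigma equation.

* §1 `theta_at_formalMul` — the substitution `u ↦ [n+1](z)`, `v ↦ z` (`F([n+1], z) = [n+2]`,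
  `F([n+1], i(z)) = [n]` by `F(g, h) = exp_W(log_W g + log_W h)`, `log_W[m] = m·log_W`,
  `log_W ∘ i = -log_W`): `σ((n+2)z)σ(nz)/(σ((n+1)z)²σ(z)²) = x(z) - x((n+1)z)`, poles cleared.
* §2 `subst_formalMul_two_mul_X_pow_three` — the `u`-derivative of the theta relation along the
  invariant derivation `D₁ = η(u)∂ᵤ` (`D₁h(u ±_F v) = (Dh)(u ±_F v)`, `SigmaODELogDerivProofs`), read on
  the diagonal `u = v = z` where `σ(u -_F v)` vanishes to first order: the DUPLICATION FORMULA
  `z³σ([2](z)) = -Ỹσ(z)⁴`, `Ỹ = z³(2y + a₁x + a₃)` (`Dx = 2y + a₁x + a₃`,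
  `X_mul_formalInvariantDerivation_formalXMulSq`), whose square is the `n = 2` identity
  (`sigmaSqDivisionIdentity_sq_two`; `Ỹ² = z⁶ψ₂²(x)`, `formalYTilde_sq`, `ΨSq₂ = Ψ₂Sq`).
* §3 — the division-polynomial side: the pole-cleared sums `Pₙ = z^{2(n²-1)}ψₙ²(x(z))`
  (`sigmaSqDivisionRHS`) and `z^{2n²}Φₙ(x(z))` are the evaluations at `(X, z²)` of Mathlib's
  `Polynomial.homogenize` of `ΨSqₙ`, `Φₙ` (`aeval_homogenize_eq_sum`), and Mathlib's definitions give
  the polynomial identity `ΨSq_{n+1}·ΨSq_{n-1} = (X·ΨSqₙ - Φₙ)²` (`ΨSq_add_one_mul_ΨSq_sub_one`, the case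
  `m = 1` of the elliptic-net relation, i.e. `x(P) - x(nP) = ψ_{n+1}ψ_{n-1}/ψₙ²`), hence the cleared
  recursion `P_{n+1}P_{n-1} = (X·Pₙ - z^{2n²}Φₙ(x))²` (`sigmaSqDivisionRHS_succ_mul_pred`,
  `homogenize_mul`).
* §4 — induction on `n` with two predecessors (`sigmaSqDivisionIdentity_sq_step`): the squared theta
  relation at `([n]z, z)`, the multiplication formula `ψₙ²(x)·x([n]z) = Φₙ(x)` of the tree
  (`sum_ΨSq_mul_formalXMulSq_subst_formalMul`, poles cleared) and the recursion give
  `Σ((n+1)z)Σ((n-1)z)·z⁴Pₙ² = P_{n+1}P_{n-1}Σ(nz)²Σ(z)²`; with the identities for `n-1` and `n` this is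
  the identity for `n+1` after cancelling non-zero factors (`Pₖ(0) = k² ≠ 0`,
  `constantCoeff_sigmaSqDivisionRHS`; `[k](z) = kz + ⋯ ≠ 0`).

The sign that Silverman's Remark 2 says cannot be fixed (`F_n = ±ψₙ`) never enters: only `ψₙ²`,
`Φₙ` and `Σ = σ²` occur (the duplication formula of §2 does carry the sign, `σ(2z) = -(2y+a₁x+a₃)σ⁴`
in the tree's orientation `z = -x/y`, and is squared at once).

## Sources

* [MazurTate1991] B. Mazur, J. Tate, *The `p`-adic sigma function*, Duke Math. J. 62 (1991), §§2–3,
  Thm. 3.1 (the list of equivalent characterisations of `σ`; not held on the hub, acq-00916 cite-only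
  — the equivalence proved here is the one this theorem states).
* [Silverman2005DivPoly] J. H. Silverman, Math. Ann. 332 (2005) (arXiv math/0404412), §1 Def. 1, §5
  Thm. 11 (= MT91 Thm. 3.1) and Remark 2 («Theorem 11 remains true for `p = 2` provided that
  everything is squared»; held text `paper:arxiv-math-0404412`, chunk p0011).
* [BlakestadGrant2023] C. Blakestad, D. Grant, J. Number Theory 249 (2023) (arXiv:1903.02480), §3
  Prop. 14 (the formal theta relation, tree theorem `thetaLHS_eq_thetaRHS`).
* [SilvermanAEC2009] J. H. Silverman, *AEC* 2nd ed., III.1, IV.1–IV.2, Exercise 3.7 (division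
  polynomials, `x(nP) = Φₙ/ψₙ²`).

## Design notes

Proofs only; no `def`, no named fact, no instance, no notation. All statements are over `ℚ_p` with
`[V.IsIntegral ℤ_[p]] [V.IsElliptic]` exactly where `thetaLHS_eq_thetaRHS` needs them; §3 is over any
commutative ring. Exponents are kept subtraction-free in §4 (`(j+1)²-1 = j²+2j`, …) so that `ring`
closes the cancellations.
-/

noncomputable section

open scoped Classical
open PowerSeries Literature.NumberTheory.EllipticCurves

namespace WeierstrassCurve

/-! ### §1. The theta relation read at `(u, v) = ([n+1](t), t)` -/

section ThetaAtMultiples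

variable {p : ℕ} [Fact p.Prime] (V : WeierstrassCurve ℚ_[p])

/-- `exp_W(n · log_W(t)) = [n](t)`: the formal multiplication is linear in the logarithmic
coordinate. [Silverman AEC IV.5.5 with IV.2.3] [cite: SilvermanAEC2009, IV.5.5] -/
theorem formalExp_subst_nsmul_formalLog [V.IsIntegral ℤ_[p]] (n : ℕ) :
    V.formalExp.subst (n • V.formalLog) = V.formalMul n := by
  have h := PowerSeries.subst_comp_subst_apply (hasSubst_formalLog V) (V.hasSubst_formalMul n)
    V.formalExp
  rw [formalExp_subst_formalLog, PowerSeries.subst_X (V.hasSubst_formalMul n),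
    V.formalLog_subst_formalMul] at h
  exact h.symm

/-- **`F([n+1](t), i(t)) = [n](t)`**: subtracting `t` in the formal group undoes one step of the
formal multiplication (`F(g, h) = exp_W(log_W g + log_W h)`, `log_W [m] = m·log_W`,
`log_W ∘ i = -log_W`). [Silverman AEC IV.2.3, IV.5.5] [cite: SilvermanAEC2009, IV.2.3] -/
theorem formalGroupLaw_subst_formalMul_succ_formalNeg [V.IsIntegral ℤ_[p]] (n : ℕ) :
    MvPowerSeries.subst ![V.formalMul (n + 1), V.formalNeg] V.formalGroupLaw = V.formalMul n := by
  rw [V.subst_pair_formalGroupLaw_eq (V.constantCoeff_formalMul (n + 1)) V.constantCoeff_formalNeg,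
    V.formalLog_subst_formalMul, formalLog_subst_formalNeg, succ_nsmul, add_neg_cancel_right,
    formalExp_subst_nsmul_formalLog]

/-- `(u -_F v)` read at `u = [n+1](t)`, `v = t` is `[n](t)`. [Silverman AEC IV.2.3] [folklore] -/
private theorem formalGroupLawSub_subst_formalMul_succ_X [V.IsIntegral ℤ_[p]] (n : ℕ) :
    MvPowerSeries.subst ![V.formalMul (n + 1), (X : ℚ_[p]⟦X⟧)] V.formalGroupLawSub = V.formalMul n := by
  have hb := V.hasSubst_formalMul_pair (n + 1)
  rw [formalGroupLawSub, MvPowerSeries.subst_comp_subst_apply V.hasSubst_pair_formalNeg hb]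
  have hfun : (fun s => MvPowerSeries.subst ![V.formalMul (n + 1), (X : ℚ_[p]⟦X⟧)]
      ((![MvPowerSeries.X 0, V.formalNeg.subst (MvPowerSeries.X 1 : MvPowerSeries (Fin 2) ℚ_[p])]) s)) =
      ![V.formalMul (n + 1), V.formalNeg] := by
    funext s
    fin_cases s
    · simp only [Fin.zero_eta, Matrix.cons_val_zero]
      rw [MvPowerSeries.subst_X hb]; rfl
    · simp only [Fin.mk_one, Matrix.cons_val_one, Matrix.cons_val_zero]
      rw [mvSubst_powerSeries_subst (PowerSeries.HasSubst.X 1) hb, MvPowerSeries.subst_X hb]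
      exact PowerSeries.X_subst V.formalNeg
  rw [hfun, formalGroupLaw_subst_formalMul_succ_formalNeg]

variable {V} in
/-- **The theta relation at `(u, v) = ([n+1](t), t)`**: for a normalised odd solution `σ` of the
sigma equation of a `p`-integral elliptic curve over `ℚ_p`,
`σ([n+2]t)·σ([n]t)·([n+1]t)²·t² = (([n+1]t)²·X(t) - t²·X([n+1]t))·σ([n+1]t)²·σ(t)²`
(`X = z²x(z)`), i.e. `σ((n+2)z)σ(nz)/(σ((n+1)z)²σ(z)²) = x(z) - x((n+1)z)` with poles cleared —
the substitution `u ↦ [n+1](t)`, `v ↦ t` in `thetaLHS_eq_thetaRHS`.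
[Mazur–Tate 1991, Thm. 3.1; Blakestad–Grant 2023, Prop. 14] [cite: BlakestadGrant2023, Prop. 14] -/
theorem theta_at_formalMul [hV : V.IsIntegral ℤ_[p]] [V.IsElliptic] {σ : ℚ_[p]⟦X⟧} {c : ℚ_[p]}
    (hσ0 : constantCoeff σ = 0) (hσ1 : coeff 1 σ = 1) (hodd : V.IsFormallyOdd σ)
    (hODE : V.SatisfiesSigmaODE σ c) (n : ℕ) :
    σ.subst (V.formalMul (n + 2)) * σ.subst (V.formalMul n) * V.formalMul (n + 1) ^ 2 * X ^ 2 =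
      (V.formalMul (n + 1) ^ 2 * V.formalXMulSq - X ^ 2 * V.formalXMulSq.subst (V.formalMul (n + 1))) *
        σ.subst (V.formalMul (n + 1)) ^ 2 * σ ^ 2 := by
  have hb := V.hasSubst_formalMul_pair (n + 1)
  have h := congrArg (MvPowerSeries.subst ![V.formalMul (n + 1), (X : ℚ_[p]⟦X⟧)])
    (thetaLHS_eq_thetaRHS hσ0 hσ1 hodd hODE)
  unfold thetaLHS thetaRHS at h
  have hX0 : MvPowerSeries.subst ![V.formalMul (n + 1), (X : ℚ_[p]⟦X⟧)]
      (MvPowerSeries.X 0 : MvPowerSeries (Fin 2) ℚ_[p]) = V.formalMul (n + 1) := by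
    rw [MvPowerSeries.subst_X hb]; rfl
  have hX1 : MvPowerSeries.subst ![V.formalMul (n + 1), (X : ℚ_[p]⟦X⟧)]
      (MvPowerSeries.X 1 : MvPowerSeries (Fin 2) ℚ_[p]) = X := by
    rw [MvPowerSeries.subst_X hb]; rfl
  have hF : MvPowerSeries.subst ![V.formalMul (n + 1), (X : ℚ_[p]⟦X⟧)] (σ.subst V.formalGroupLaw) =
      σ.subst (V.formalMul (n + 2)) := by
    rw [mvSubst_powerSeries_subst V.hasSubst_formalGroupLaw hb, ← formalMul_succ]
  have hFm : MvPowerSeries.subst ![V.formalMul (n + 1), (X : ℚ_[p]⟦X⟧)] (σ.subst V.formalGroupLawSub) =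
      σ.subst (V.formalMul n) := by
    rw [mvSubst_powerSeries_subst V.hasSubst_formalGroupLawSub hb,
      formalGroupLawSub_subst_formalMul_succ_X]
  have hf0 : ∀ f : ℚ_[p]⟦X⟧, MvPowerSeries.subst ![V.formalMul (n + 1), (X : ℚ_[p]⟦X⟧)]
      (f.subst (MvPowerSeries.X 0 : MvPowerSeries (Fin 2) ℚ_[p])) = f.subst (V.formalMul (n + 1)) :=
    fun f => by rw [mvSubst_powerSeries_subst (PowerSeries.HasSubst.X 0) hb, hX0]
  have hf1 : ∀ f : ℚ_[p]⟦X⟧, MvPowerSeries.subst ![V.formalMul (n + 1), (X : ℚ_[p]⟦X⟧)]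
      (f.subst (MvPowerSeries.X 1 : MvPowerSeries (Fin 2) ℚ_[p])) = f :=
    fun f => by rw [mvSubst_powerSeries_subst (PowerSeries.HasSubst.X 1) hb, hX1, PowerSeries.X_subst]
  simp only [MvPowerSeries.subst_mul hb, MvPowerSeries.subst_pow hb, MvPowerSeries.subst_sub hb,
    hX0, hX1, hF, hFm, hf0, hf1] at h
  exact h

end ThetaAtMultiples

/-! ### §2. The duplication formula `t³σ([2]t) = -Ỹσ⁴` (the `u`-derivative of the theta relation on
the diagonal) and the squared `2`-division identity -/

section Duplication

variable {p : ℕ} [Fact p.Prime] (V : WeierstrassCurve ℚ_[p])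

/-- The diagonal substitution `u, v ↦ t` is admissible. [folklore] -/
private theorem hasSubst_X_X : MvPowerSeries.HasSubst ![(X : ℚ_[p]⟦X⟧), X] :=
  hasSubst_pair_X constantCoeff_X

/-- `(u -_F v)` vanishes on the diagonal: `F(t, i(t)) = 0`. [Silverman AEC IV.2.1 (d)] [folklore] -/
private theorem formalGroupLawSub_subst_X_X :
    MvPowerSeries.subst ![(X : ℚ_[p]⟦X⟧), X] V.formalGroupLawSub = 0 := by
  have hb := hasSubst_X_X (p := p)
  rw [formalGroupLawSub, MvPowerSeries.subst_comp_subst_apply V.hasSubst_pair_formalNeg hb]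
  have hfun : (fun s => MvPowerSeries.subst ![(X : ℚ_[p]⟦X⟧), X]
      ((![MvPowerSeries.X 0, V.formalNeg.subst (MvPowerSeries.X 1 : MvPowerSeries (Fin 2) ℚ_[p])]) s)) =
      ![(X : ℚ_[p]⟦X⟧), V.formalNeg] := by
    funext s
    fin_cases s
    · simp only [Fin.zero_eta, Matrix.cons_val_zero]
      rw [MvPowerSeries.subst_X hb]; rfl
    · simp only [Fin.mk_one, Matrix.cons_val_one, Matrix.cons_val_zero]
      rw [mvSubst_powerSeries_subst (PowerSeries.HasSubst.X 1) hb, MvPowerSeries.subst_X hb]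
      exact PowerSeries.X_subst V.formalNeg
  rw [hfun, formalGroupLaw_subst_X_formalNeg']

/-- `(Dσ)(0) = σ'(0) = 1` for `σ = t + ⋯` (`η(0) = 1`). [folklore] -/
private theorem constantCoeff_formalInvariantDerivation_eq_one {σ : ℚ_[p]⟦X⟧} (hσ1 : coeff 1 σ = 1) :
    constantCoeff (V.formalInvariantDerivation σ) = 1 := by
  rw [formalInvariantDerivation_apply, map_mul, constantCoeff_formalEta, constantCoeff_derivative, hσ1,
    one_mul]

variable {V} in
/-- **The duplication formula from the theta relation** (its `u`-derivative along `D₁ = η(u)∂ᵤ`,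
read on the diagonal `u = v = t`, where `σ(u -_F v)` vanishes to first order with
`D₁(u -_F v)|_{u=v} = 1`): `t⁴·σ([2](t)) = (2tηX - t²·DX)·σ(t)⁴` (`X = z²x`, `D = d/ω`), i.e.
`σ(2z)/σ(z)⁴ = -Dx = -(2y + a₁x + a₃)`. [Mazur–Tate 1991, Thm. 3.1 (`σ(2Q) = σ(Q)⁴F₂(Q)`);
Silverman 2005, §5 Thm. 11 (18) for `n = 2`] [cite: Silverman2005DivPoly, §5 Thm. 11] -/
theorem subst_formalMul_two_mul_X_pow_four [hV : V.IsIntegral ℤ_[p]] [V.IsElliptic] {σ : ℚ_[p]⟦X⟧}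
    {c : ℚ_[p]} (hσ0 : constantCoeff σ = 0) (hσ1 : coeff 1 σ = 1) (hodd : V.IsFormallyOdd σ)
    (hODE : V.SatisfiesSigmaODE σ c) :
    σ.subst (V.formalMul 2) * X ^ 4 =
      (2 * X * V.formalEta * V.formalXMulSq - X ^ 2 * V.formalInvariantDerivation V.formalXMulSq) *
        σ ^ 4 := by
  have hb := hasSubst_X_X (p := p)
  set D₁ := V.formalInvariantDerivationMv (0 : Fin 2) with hD₁
  set u := (MvPowerSeries.X 0 : MvPowerSeries (Fin 2) ℚ_[p]) with hu
  set v := (MvPowerSeries.X 1 : MvPowerSeries (Fin 2) ℚ_[p]) with hv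
  -- the derivative of the theta relation
  have hθ := congrArg D₁ (thetaLHS_eq_thetaRHS hσ0 hσ1 hodd hODE)
  have hDu : D₁ u = V.formalEta.subst u := by rw [hD₁, hu]; exact V.formalInvariantDerivationMv_X_self 0
  have hDv : D₁ v = 0 := by rw [hD₁, hv]; exact V.formalInvariantDerivationMv_X_of_ne (by decide)
  have hDF : D₁ (σ.subst V.formalGroupLaw) = (V.formalInvariantDerivation σ).subst V.formalGroupLaw := by
    rw [hD₁]; exact V.formalInvariantDerivationMv_subst_formalGroupLaw σ
  have hDFm : D₁ (σ.subst V.formalGroupLawSub) =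
      (V.formalInvariantDerivation σ).subst V.formalGroupLawSub := by
    rw [hD₁]; exact V.formalInvariantDerivationMv_subst_formalGroupLawSub σ
  have hDσu : D₁ (σ.subst u) = (V.formalInvariantDerivation σ).subst u := by
    rw [hD₁, hu]; exact V.formalInvariantDerivationMv_subst_X_zero σ
  have hDσv : D₁ (σ.subst v) = 0 := by rw [hD₁, hv]; exact V.formalInvariantDerivationMv_subst_X_one σ
  have hDXu : D₁ (V.formalXMulSq.subst u) = (V.formalInvariantDerivation V.formalXMulSq).subst u := by
    rw [hD₁, hu]; exact V.formalInvariantDerivationMv_subst_X_zero _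
  have hDXv : D₁ (V.formalXMulSq.subst v) = 0 := by
    rw [hD₁, hv]; exact V.formalInvariantDerivationMv_subst_X_one _
  unfold thetaLHS thetaRHS at hθ
  rw [← hu, ← hv] at hθ
  simp only [Derivation.leibniz, Derivation.leibniz_pow, map_sub, smul_eq_mul, nsmul_eq_mul, Nat.cast_ofNat,
    Nat.add_one_sub_one, pow_one, hDu, hDv, hDF, hDFm, hDσu, hDσv, hDXu, hDXv, mul_zero, add_zero] at hθ
  -- read on the diagonal
  have hΔ := congrArg (MvPowerSeries.subst ![(X : ℚ_[p]⟦X⟧), X]) hθ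
  have hX0 : MvPowerSeries.subst ![(X : ℚ_[p]⟦X⟧), X] u = X := by rw [hu, MvPowerSeries.subst_X hb]; rfl
  have hX1 : MvPowerSeries.subst ![(X : ℚ_[p]⟦X⟧), X] v = X := by rw [hv, MvPowerSeries.subst_X hb]; rfl
  have hf0 : ∀ f : ℚ_[p]⟦X⟧, MvPowerSeries.subst ![(X : ℚ_[p]⟦X⟧), X] (f.subst u) = f := fun f => by
    rw [mvSubst_powerSeries_subst (PowerSeries.HasSubst.X 0) hb, hX0, PowerSeries.X_subst]
  have hf1 : ∀ f : ℚ_[p]⟦X⟧, MvPowerSeries.subst ![(X : ℚ_[p]⟦X⟧), X] (f.subst v) = f := fun f => by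
    rw [mvSubst_powerSeries_subst (PowerSeries.HasSubst.X 1) hb, hX1, PowerSeries.X_subst]
  have hF : ∀ f : ℚ_[p]⟦X⟧, MvPowerSeries.subst ![(X : ℚ_[p]⟦X⟧), X] (f.subst V.formalGroupLaw) =
      f.subst (V.formalMul 2) := fun f => by
    rw [mvSubst_powerSeries_subst V.hasSubst_formalGroupLaw hb, ← formalMul_two]
  have hFmσ : MvPowerSeries.subst ![(X : ℚ_[p]⟦X⟧), X] (σ.subst V.formalGroupLawSub) = 0 := by
    rw [mvSubst_powerSeries_subst V.hasSubst_formalGroupLawSub hb, formalGroupLawSub_subst_X_X,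
      PowerSeries.subst_zero_of_constantCoeff_zero hσ0]
  have hFmDσ : MvPowerSeries.subst ![(X : ℚ_[p]⟦X⟧), X]
      ((V.formalInvariantDerivation σ).subst V.formalGroupLawSub) = 1 := by
    rw [mvSubst_powerSeries_subst V.hasSubst_formalGroupLawSub hb, formalGroupLawSub_subst_X_X,
      PowerSeries.subst_zero_eq_C_constantCoeff, V.constantCoeff_formalInvariantDerivation_eq_one hσ1,
      map_one, map_one]
  simp only [MvPowerSeries.subst_mul hb, MvPowerSeries.subst_pow hb, MvPowerSeries.subst_sub hb,
    MvPowerSeries.subst_add hb, hX0, hX1, hf0, hf1, hF, hFmσ, hFmDσ] at hΔ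
  have h2 : MvPowerSeries.subst ![(X : ℚ_[p]⟦X⟧), X] (2 : MvPowerSeries (Fin 2) ℚ_[p]) = 2 := by
    rw [← MvPowerSeries.coe_substAlgHom hb, map_ofNat]
  have h0 : MvPowerSeries.subst ![(X : ℚ_[p]⟦X⟧), X] (0 : MvPowerSeries (Fin 2) ℚ_[p]) = 0 := by
    rw [← MvPowerSeries.coe_substAlgHom hb, map_zero]
  rw [h2, h0] at hΔ
  linear_combination hΔ

variable {V} in
/-- **`t³·σ([2](t)) = -Ỹ·σ(t)⁴`** with `Ỹ = (a₁z - 2)X + a₃z³ = z³(2y + a₁x + a₃)`: the duplication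
formula `σ(2z) = -(2y + a₁x + a₃)·σ(z)⁴` (`= σ(z)⁴·F₂` with `F₂ = -ψ₂` in the orientation `z = -x/y`).
[Mazur–Tate 1991, Thm. 3.1; Silverman 2005, §5 Thm. 11 (18), `n = 2`] [cite: Silverman2005DivPoly, §5 Thm. 11] -/
theorem subst_formalMul_two_mul_X_pow_three [hV : V.IsIntegral ℤ_[p]] [V.IsElliptic] {σ : ℚ_[p]⟦X⟧}
    {c : ℚ_[p]} (hσ0 : constantCoeff σ = 0) (hσ1 : coeff 1 σ = 1) (hodd : V.IsFormallyOdd σ)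
    (hODE : V.SatisfiesSigmaODE σ c) :
    σ.subst (V.formalMul 2) * X ^ 3 =
      -((C V.a₁ * X - 2) * V.formalXMulSq + C V.a₃ * X ^ 3) * σ ^ 4 := by
  have h4 := subst_formalMul_two_mul_X_pow_four hσ0 hσ1 hodd hODE
  have hDX := V.X_mul_formalInvariantDerivation_formalXMulSq
  apply PowerSeries.X_mul_cancel
  linear_combination h4 - X * σ ^ 4 * hDX

/-- `P₂ = 4X³ + b₂z²X² + 2b₄z⁴X + b₆z⁶` (`ΨSq₂ = Ψ₂Sq = 4x³ + b₂x² + 2b₄x + b₆`).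
[Silverman AEC III.1, Ex. 3.7] [cite: SilvermanAEC2009, Exercise 3.7] -/
theorem sigmaSqDivisionRHS_two :
    V.sigmaSqDivisionRHS 2 = 4 * V.formalXMulSq ^ 3 + C V.b₂ * X ^ 2 * V.formalXMulSq ^ 2 +
      2 * C V.b₄ * X ^ 4 * V.formalXMulSq + C V.b₆ * X ^ 6 := by
  rw [sigmaSqDivisionRHS, show (2 : ℕ) ^ 2 = 3 + 1 from rfl]
  have hΨ : V.ΨSq ((2 : ℕ) : ℤ) = V.Ψ₂Sq := V.ΨSq_two
  simp only [hΨ, Ψ₂Sq, Finset.sum_range_succ, Finset.sum_range_zero, zero_add, Polynomial.coeff_add,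
    Polynomial.coeff_C_mul, Polynomial.coeff_X_pow, Polynomial.coeff_C, Polynomial.coeff_X]
  norm_num
  rw [show (C 4 : ℚ_[p]⟦X⟧) = 4 from map_ofNat C 4, show (C 2 : ℚ_[p]⟦X⟧) = 2 from map_ofNat C 2]
  ring

variable {V} in
/-- **The squared `2`-division identity for `Σ = σ²`**: `z⁶·Σ([2](z)) = Σ(z)⁴·P₂(z)`, i.e.
`σ²(2Q) = σ²(Q)⁴·F₂(Q)²` with `F₂² = ψ₂² = 4x³ + b₂x² + 2b₄x + b₆` — the square of the duplication
formula. [Silverman 2005, §5 Thm. 11 (18) and Rem. 2, `n = 2`; Mazur–Tate 1991, Thm. 3.1]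
[cite: Silverman2005DivPoly, §5 Rem. 2] -/
theorem sigmaSqDivisionIdentity_sq_two [hV : V.IsIntegral ℤ_[p]] [V.IsElliptic] {σ : ℚ_[p]⟦X⟧}
    {c : ℚ_[p]} (hσ0 : constantCoeff σ = 0) (hσ1 : coeff 1 σ = 1) (hodd : V.IsFormallyOdd σ)
    (hODE : V.SatisfiesSigmaODE σ c) : V.SigmaSqDivisionIdentity (σ ^ 2) 2 := by
  have h3 := subst_formalMul_two_mul_X_pow_three hσ0 hσ1 hodd hODE
  have hY := V.formalYTilde_sq
  rw [SigmaSqDivisionIdentity, sigmaSqDivisionRHS_two, PowerSeries.subst_pow (V.hasSubst_formalMul 2)]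
  norm_num
  set Y := (C V.a₁ * X - 2) * V.formalXMulSq + C V.a₃ * X ^ 3 with hYdef
  have hsq : (σ.subst (V.formalMul 2) * X ^ 3) ^ 2 = (Y * σ ^ 4) ^ 2 := by rw [h3, neg_mul, neg_sq]
  linear_combination hsq + σ ^ 8 * hY

end Duplication

/-! ### §3. Division polynomials read on the formal group: the pole-cleared sums `Pₙ = z^{2(n²-1)}ψₙ²(x(z))`,
`z^{2n²}Φₙ(x(z))` as evaluations of homogenised polynomials, and the recursion
`ΨSq_{n+1}·ΨSq_{n-1} = (X·ΨSqₙ - Φₙ)²` -/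

section Clearing

variable {R : Type*} [CommRing R] (W : WeierstrassCurve R)

/-- **Clearing the poles of `f(x(z))` by `z^{2d}` is evaluating the homogenisation of `f`** at
`(X, z²)` (`x = X/z²`): `(hom_d f)(X, z²) = Σ_{i ≤ d} f[i]·Xⁱ·z^{2(d-i)}`. [folklore] -/
private theorem aeval_homogenize_eq_sum (f : Polynomial R) (d : ℕ) :
    MvPolynomial.aeval ![W.formalXMulSq, (X : R⟦X⟧) ^ 2] (f.homogenize d) =
      ∑ i ∈ Finset.range (d + 1), C (f.coeff i) * W.formalXMulSq ^ i * X ^ (2 * (d - i)) := by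
  simp only [Polynomial.homogenize, Finset.Nat.sum_antidiagonal_eq_sum_range_succ_mk, map_sum]
  refine Finset.sum_congr rfl fun k _ => ?_
  rw [MvPolynomial.aeval_monomial, Finsupp.update_eq_add_single, Finsupp.prod_add_index',
    Finsupp.prod_single_index, Finsupp.prod_single_index]
  · simp only [Matrix.cons_val_zero, Matrix.cons_val_one, ← pow_mul, ← PowerSeries.C_eq_algebraMap,
      mul_assoc]
  all_goals simp_all [pow_add]

/-- `Pₙ = (hom_{n²-1} ΨSqₙ)(X, z²)` for `n ≥ 1`. [Silverman 2005, §1 Def. 1] [folklore] -/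
private theorem sigmaSqDivisionRHS_eq_aeval {p : ℕ} [Fact p.Prime] (V : WeierstrassCurve ℚ_[p]) {n : ℕ}
    (hn : 1 ≤ n) :
    V.sigmaSqDivisionRHS n =
      MvPolynomial.aeval ![V.formalXMulSq, (X : ℚ_[p]⟦X⟧) ^ 2] ((V.ΨSq n).homogenize (n ^ 2 - 1)) := by
  rw [aeval_homogenize_eq_sum, sigmaSqDivisionRHS, Nat.sub_add_cancel (Nat.one_le_pow _ _ hn)]

/-- `z^{2n²}Φₙ(x(z))`, cleared, is `(hom_{n²} Φₙ)(X, z²)`. [Silverman AEC Ex. 3.7] [folklore] -/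
private theorem sum_Φ_eq_aeval (n : ℕ) :
    (∑ i ∈ Finset.range (n ^ 2 + 1),
        C ((W.Φ n).coeff i) * W.formalXMulSq ^ i * X ^ (2 * (n ^ 2 - i))) =
      MvPolynomial.aeval ![W.formalXMulSq, (X : R⟦X⟧) ^ 2] ((W.Φ n).homogenize (n ^ 2)) := by
  rw [aeval_homogenize_eq_sum]

/-- **`ΨSq_{n+1}·ΨSq_{n-1} = (X·ΨSqₙ - Φₙ)²`** in `R[X]`: by Mathlib's definitions
`ΨSqₘ = preΨₘ²·(Ψ₂Sq if m even else 1)` and `Φₙ = X·ΨSqₙ - preΨ_{n+1}preΨ_{n-1}·(1 if n even else Ψ₂Sq)`,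
both sides are `preΨ_{n+1}²·preΨ_{n-1}²·(1 if n even else Ψ₂Sq²)`. This is the case `m = 1` of the
elliptic-net relation `ψ_{n+m}ψ_{n-m}ψ₁² = …`, i.e. `x(P) - x(nP) = ψ_{n+1}ψ_{n-1}/ψₙ²`.
[Silverman AEC Ex. 3.7 (d)] [cite: SilvermanAEC2009, Exercise 3.7] -/
theorem ΨSq_add_one_mul_ΨSq_sub_one (n : ℤ) :
    W.ΨSq (n + 1) * W.ΨSq (n - 1) = (Polynomial.X * W.ΨSq n - W.Φ n) ^ 2 := by
  have hΦ : Polynomial.X * W.ΨSq n - W.Φ n =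
      W.preΨ (n + 1) * W.preΨ (n - 1) * (if Even n then 1 else W.Ψ₂Sq) := by
    rw [WeierstrassCurve.Φ]; ring
  rw [hΦ, ΨSq, ΨSq]
  rcases Int.even_or_odd n with hn | hn
  · have h1 : ¬ Even (n + 1) := Int.not_even_iff_odd.mpr hn.add_one
    have h2 : ¬ Even (n - 1) := Int.not_even_iff_odd.mpr (hn.sub_odd odd_one)
    simp only [hn, h1, h2, if_true, if_false]; ring
  · have h1 : Even (n + 1) := hn.add_one
    have h2 : Even (n - 1) := hn.sub_odd odd_one
    simp only [Int.not_even_iff_odd.mpr hn, h1, h2, if_true, if_false]; ring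

/-- **The cleared recursion `P_{n+1}·P_{n-1} = (X·Pₙ - z^{2n²}Φₙ(x))²`** in `ℚ_p⟦z⟧` (`n ≥ 1`):
`ΨSq_{n+1}ΨSq_{n-1} = (XΨSqₙ - Φₙ)²` homogenised in degree `2n² = ((n+1)²-1) + ((n-1)²-1)` and
evaluated at `(X, z²)`. [Silverman AEC Ex. 3.7 (d); Silverman 2005, §1] [cite: SilvermanAEC2009, Exercise 3.7] -/
theorem sigmaSqDivisionRHS_succ_mul_pred {p : ℕ} [Fact p.Prime] (V : WeierstrassCurve ℚ_[p]) {n : ℕ}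
    (hn : 1 ≤ n) :
    V.sigmaSqDivisionRHS (n + 1) * V.sigmaSqDivisionRHS (n - 1) =
      (V.formalXMulSq * V.sigmaSqDivisionRHS n -
        ∑ i ∈ Finset.range (n ^ 2 + 1),
          C ((V.Φ n).coeff i) * V.formalXMulSq ^ i * X ^ (2 * (n ^ 2 - i))) ^ 2 := by
  rcases Nat.eq_or_lt_of_le hn with rfl | hn2
  · -- `n = 1`: `P₀ = 0` and `X·P₁ - z²Φ₁(x) = X - X = 0`
    simp [sigmaSqDivisionRHS, Finset.sum_range_succ]
  have hn1 : 1 ≤ n - 1 := by omega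
  rw [V.sigmaSqDivisionRHS_eq_aeval (by omega : 1 ≤ n + 1), V.sigmaSqDivisionRHS_eq_aeval hn1,
    V.sigmaSqDivisionRHS_eq_aeval hn, sum_Φ_eq_aeval, ← map_mul]
  -- degrees
  have hdΨ : ∀ m : ℕ, (V.ΨSq m).natDegree ≤ m ^ 2 - 1 := fun m => by
    have h := V.natDegree_ΨSq_le (m : ℤ); rwa [Int.natAbs_natCast] at h
  have hdΦ : (V.Φ n).natDegree ≤ n ^ 2 := by
    have h := V.natDegree_Φ_le (n : ℤ); rwa [Int.natAbs_natCast] at h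
  have hdX : (Polynomial.X * V.ΨSq n).natDegree ≤ 1 + (n ^ 2 - 1) :=
    (Polynomial.natDegree_mul_le).trans (add_le_add Polynomial.natDegree_X_le (hdΨ n))
  have hdeg : (n + 1) ^ 2 - 1 + ((n - 1) ^ 2 - 1) = n ^ 2 + n ^ 2 := by
    obtain ⟨k, rfl⟩ : ∃ k, n = k + 2 := ⟨n - 2, by omega⟩
    rw [show k + 2 - 1 = k + 1 by omega]; ring_nf; omega
  have hn2' : 1 + (n ^ 2 - 1) = n ^ 2 := by have := Nat.one_le_pow 2 n hn; omega
  have hdS : (Polynomial.X * V.ΨSq n - V.Φ n).natDegree ≤ n ^ 2 :=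
    (Polynomial.natDegree_sub_le _ _).trans (max_le (hn2' ▸ hdX) hdΦ)
  have e1 : (V.ΨSq ((n + 1 : ℕ) : ℤ)).homogenize ((n + 1) ^ 2 - 1) *
      (V.ΨSq ((n - 1 : ℕ) : ℤ)).homogenize ((n - 1) ^ 2 - 1) =
      (V.ΨSq ((n + 1 : ℕ) : ℤ) * V.ΨSq ((n - 1 : ℕ) : ℤ)).homogenize (n ^ 2 + n ^ 2) := by
    rw [← hdeg, Polynomial.homogenize_mul _ _ (hdΨ _) (hdΨ _)]
  have e2 : V.ΨSq ((n + 1 : ℕ) : ℤ) * V.ΨSq ((n - 1 : ℕ) : ℤ) = (Polynomial.X * V.ΨSq n - V.Φ n) ^ 2 := by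
    rw [show ((n + 1 : ℕ) : ℤ) = (n : ℤ) + 1 by push_cast; ring,
      show ((n - 1 : ℕ) : ℤ) = (n : ℤ) - 1 by rw [Nat.cast_sub hn]; push_cast; ring]
    exact V.ΨSq_add_one_mul_ΨSq_sub_one n
  have e3 : ((Polynomial.X * V.ΨSq n - V.Φ n) ^ 2).homogenize (n ^ 2 + n ^ 2) =
      ((Polynomial.X * V.ΨSq n - V.Φ n).homogenize (n ^ 2)) ^ 2 := by
    rw [pow_two (Polynomial.X * V.ΨSq n - V.Φ n), Polynomial.homogenize_mul _ _ hdS hdS, ← pow_two]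
  have e4 : (Polynomial.X * V.ΨSq n - V.Φ n).homogenize (n ^ 2) =
      MvPolynomial.X 0 * (V.ΨSq n).homogenize (n ^ 2 - 1) - (V.Φ n).homogenize (n ^ 2) := by
    rw [Polynomial.homogenize_sub, ← hn2', Polynomial.homogenize_mul _ _ Polynomial.natDegree_X_le (hdΨ n),
      Polynomial.homogenize_X one_ne_zero, hn2']
    simp
  rw [e1, e2, e3, map_pow, e4, map_sub, map_mul, MvPolynomial.aeval_X]
  rfl

end Clearing

/-! ### §4. The induction: all squared `n`-division identities for `Σ = σ²` -/

section Induction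

variable {p : ℕ} [Fact p.Prime] (V : WeierstrassCurve ℚ_[p])

/-- `Pₙ(0) = n²` (`ψₙ = n·x^{(n²-1)/2} + ⋯`: the top coefficient of `ΨSqₙ` is `n²`, `X(0) = 1`).
[Silverman AEC Ex. 3.7 (b); Silverman 2005, §1 Def. 1 ("`(z^{n²-1}F_n)(𝒪) = n`")]
[cite: Silverman2005DivPoly, §1 Def. 1] -/
theorem constantCoeff_sigmaSqDivisionRHS {n : ℕ} (hn : 1 ≤ n) :
    constantCoeff (V.sigmaSqDivisionRHS n) = (n : ℚ_[p]) ^ 2 := by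
  have hn2 : 1 ≤ n ^ 2 := Nat.one_le_pow _ _ hn
  have hc : (V.ΨSq (n : ℤ)).coeff (n ^ 2 - 1) = (n : ℚ_[p]) ^ 2 := by
    have h := V.coeff_ΨSq (n : ℤ)
    rw [Int.natAbs_natCast] at h
    rw [h]; push_cast; ring
  rw [sigmaSqDivisionRHS, map_sum, Finset.sum_eq_single (n ^ 2 - 1)]
  · rw [Nat.sub_self, mul_zero, pow_zero, mul_one, map_mul, map_pow, constantCoeff_C,
      constantCoeff_formalXMulSq, one_pow, mul_one, hc]
  · intro i hi hne
    have hlt : i < n ^ 2 - 1 := lt_of_le_of_ne (by have := Finset.mem_range.mp hi; omega) hne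
    rw [map_mul, map_pow, constantCoeff_X, zero_pow (by omega), mul_zero]
  · intro h
    exact absurd (Finset.mem_range.mpr (by omega)) h

/-- `Pₙ ≠ 0` for `n ≥ 1` (`Pₙ(0) = n²`). [cite: Silverman2005DivPoly, §1 Def. 1] -/
theorem sigmaSqDivisionRHS_ne_zero {n : ℕ} (hn : 1 ≤ n) : V.sigmaSqDivisionRHS n ≠ 0 := by
  intro h
  have h0 := congrArg constantCoeff h
  rw [V.constantCoeff_sigmaSqDivisionRHS hn, map_zero] at h0
  exact pow_ne_zero 2 (Nat.cast_ne_zero.mpr (by omega)) h0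

/-- `[n](t) ≠ 0` for `n ≥ 1` (its linear coefficient is `n`). [Silverman AEC IV.2.3(a)]
[cite: SilvermanAEC2009, IV.2.3] -/
theorem formalMul_ne_zero {n : ℕ} (hn : 1 ≤ n) : V.formalMul n ≠ 0 := by
  intro h
  have h1 := congrArg (coeff 1) h
  rw [V.coeff_one_formalMul' n, map_zero] at h1
  exact (Nat.cast_ne_zero.mpr (by omega)) h1

/-- `(∗)` for `Pₙ`: `Pₙ · z² · X([n](z)) = (z^{2n²}Φₙ(x(z))) · [n](z)²` — the tree's
`sum_ΨSq_mul_formalXMulSq_subst_formalMul` (`ψₙ²(x)·x([n]P) = Φₙ(x)`, poles cleared).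
[Silverman AEC Ex. 3.7 (d)] [cite: SilvermanAEC2009, Exercise 3.7] -/
theorem sigmaSqDivisionRHS_mul_X_sq_mul_subst (n : ℕ) :
    V.sigmaSqDivisionRHS n * X ^ 2 * V.formalXMulSq.subst (V.formalMul n) =
      (∑ i ∈ Finset.range (n ^ 2 + 1),
          C ((V.Φ n).coeff i) * V.formalXMulSq ^ i * X ^ (2 * (n ^ 2 - i))) * V.formalMul n ^ 2 :=
  V.sum_ΨSq_mul_formalXMulSq_subst_formalMul n

variable {V} in
/-- **The induction step** (`j+1, j+2 ⟹ j+3`): from the theta relation at `([j+2]t, t)` (squared),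
the multiplication formula `(∗)` and the cleared recursion `P_{j+3}P_{j+1} = (XP_{j+2} - z^{2(j+2)²}Φ_{j+2})²`
one gets `σ²((j+3)z)σ²((j+1)z)z⁴P_{j+2}² = P_{j+3}P_{j+1}σ²((j+2)z)²σ(z)⁴`, and the two previous
identities turn this into the one for `j+3` (cancellations in the domain `ℚ_p⟦z⟧`).
[Mazur–Tate 1991, Thm. 3.1; Silverman 2005, §5 Thm. 11 (18) and Rem. 2] [cite: Silverman2005DivPoly, §5 Rem. 2] -/
theorem sigmaSqDivisionIdentity_sq_step [hV : V.IsIntegral ℤ_[p]] [V.IsElliptic] {σ : ℚ_[p]⟦X⟧}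
    {c : ℚ_[p]} (hσ0 : constantCoeff σ = 0) (hσ1 : coeff 1 σ = 1) (hodd : V.IsFormallyOdd σ)
    (hODE : V.SatisfiesSigmaODE σ c) (j : ℕ) (h₁ : V.SigmaSqDivisionIdentity (σ ^ 2) (j + 1))
    (h₂ : V.SigmaSqDivisionIdentity (σ ^ 2) (j + 2)) : V.SigmaSqDivisionIdentity (σ ^ 2) (j + 3) := by
  -- exponents without truncated subtraction
  have ea : (j + 1) ^ 2 - 1 = j ^ 2 + 2 * j := Nat.sub_eq_of_eq_add (by ring)
  have eb : (j + 2) ^ 2 - 1 = j ^ 2 + 4 * j + 3 := Nat.sub_eq_of_eq_add (by ring)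
  have ec : (j + 3) ^ 2 - 1 = j ^ 2 + 6 * j + 8 := Nat.sub_eq_of_eq_add (by ring)
  rw [SigmaSqDivisionIdentity, PowerSeries.subst_pow (V.hasSubst_formalMul _)] at h₁ h₂ ⊢
  rw [ea] at h₁
  rw [eb] at h₂
  rw [ec]
  -- the players
  set σm := σ.subst (V.formalMul (j + 1)) with hσm
  set σ₁ := σ.subst (V.formalMul (j + 2)) with hσ₁
  set σp := σ.subst (V.formalMul (j + 3)) with hσp
  set m := V.formalMul (j + 2) with hm
  set Xq := V.formalXMulSq with hXq
  set Xqm := V.formalXMulSq.subst (V.formalMul (j + 2)) with hXqm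
  set P := V.sigmaSqDivisionRHS (j + 2) with hP
  set Pm := V.sigmaSqDivisionRHS (j + 1) with hPm
  set Pp := V.sigmaSqDivisionRHS (j + 3) with hPp
  set Q := ∑ i ∈ Finset.range ((j + 2) ^ 2 + 1),
    C ((V.Φ ((j + 2 : ℕ) : ℤ)).coeff i) * V.formalXMulSq ^ i * X ^ (2 * ((j + 2) ^ 2 - i)) with hQ
  -- (T) the theta relation at `([j+2]t, t)`
  have hT : σp * σm * m ^ 2 * X ^ 2 = (m ^ 2 * Xq - X ^ 2 * Xqm) * σ₁ ^ 2 * σ ^ 2 :=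
    theta_at_formalMul hσ0 hσ1 hodd hODE (j + 1)
  -- (∗) and the cleared recursion
  have hstar : P * X ^ 2 * Xqm = Q * m ^ 2 := V.sigmaSqDivisionRHS_mul_X_sq_mul_subst (j + 2)
  have hR : Pp * Pm = (Xq * P - Q) ^ 2 := by
    have h := V.sigmaSqDivisionRHS_succ_mul_pred (n := j + 2) (by omega)
    rwa [show j + 2 - 1 = j + 1 from rfl] at h
  -- non-vanishing
  have hm0 : m ≠ 0 := V.formalMul_ne_zero (by omega)
  have hP0 : P ≠ 0 := V.sigmaSqDivisionRHS_ne_zero (by omega)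
  have hPm0 : Pm ≠ 0 := V.sigmaSqDivisionRHS_ne_zero (by omega)
  have hσne : σ ≠ 0 := fun h => by
    have := congrArg (coeff 1) h; rw [hσ1, map_zero] at this; exact one_ne_zero this
  have hX0 : (X : ℚ_[p]⟦X⟧) ≠ 0 := X_ne_zero
  -- (E1): `σp²σm²z⁴P² = Pp·Pm·σ₁⁴σ⁴` (cancel `m⁴`)
  have hT2 : σp ^ 2 * σm ^ 2 * m ^ 4 * X ^ 4 = (m ^ 2 * Xq - X ^ 2 * Xqm) ^ 2 * σ₁ ^ 4 * σ ^ 4 := by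
    linear_combination (σp * σm * m ^ 2 * X ^ 2 + (m ^ 2 * Xq - X ^ 2 * Xqm) * σ₁ ^ 2 * σ ^ 2) * hT
  have hstar' : P * (m ^ 2 * Xq - X ^ 2 * Xqm) = m ^ 2 * (Xq * P - Q) := by linear_combination -hstar
  have E1 : σp ^ 2 * σm ^ 2 * X ^ 4 * P ^ 2 = Pp * Pm * σ₁ ^ 4 * σ ^ 4 := by
    refine mul_left_cancel₀ (pow_ne_zero 4 hm0) ?_
    linear_combination P ^ 2 * hT2 +
      (σ₁ ^ 4 * σ ^ 4 * (P * (m ^ 2 * Xq - X ^ 2 * Xqm) + m ^ 2 * (Xq * P - Q))) * hstar' -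
      (m ^ 4 * σ₁ ^ 4 * σ ^ 4) * hR
  -- conclude by cancelling `N = P²·Pm·(σ²)^{(j+1)²}·z^{2a}`
  have hN : P ^ 2 * Pm * (σ ^ 2) ^ ((j + 1) ^ 2) * X ^ (2 * (j ^ 2 + 2 * j)) ≠ 0 :=
    mul_ne_zero (mul_ne_zero (mul_ne_zero (pow_ne_zero 2 hP0) hPm0) (pow_ne_zero _ (pow_ne_zero 2 hσne)))
      (pow_ne_zero _ hX0)
  refine mul_right_cancel₀ hN ?_
  linear_combination (-(X ^ (2 * (j ^ 2 + 6 * j + 8) + 2 * (j ^ 2 + 2 * j)) * σp ^ 2 * P ^ 2)) * h₁ +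
    X ^ (2 * (j ^ 2 + 2 * j) + 4 * (j ^ 2 + 4 * j + 3)) * E1 +
    (X ^ (2 * (j ^ 2 + 2 * j)) * Pp * Pm * (σ ^ 2) ^ 2 *
      (X ^ (2 * (j ^ 2 + 4 * j + 3)) * σ₁ ^ 2 + (σ ^ 2) ^ ((j + 2) ^ 2) * P)) * h₂

variable {V} in
/-- **Mazur–Tate 1991, Thm. 3.1 — the differential equation gives the division polynomials.** For a
`p`-integral elliptic curve `V/ℚ_p` (any prime `p`) and ANY normalised odd solution `σ = z + ⋯` of the
sigma equation `x + c = -D(Dσ/σ)` (no integrality of `σ` or `c` required), the square `Σ = σ²`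
satisfies every squared `n`-division identity `z^{2(n²-1)}·Σ([n](z)) = Σ(z)^{n²}·z^{2(n²-1)}ψₙ²(x(z))`,
`n ≥ 1` — Silverman's «`σ²(nQ) = σ(Q)^{2n²}F_n²(Q)`». [Mazur–Tate 1991, Thm. 3.1; Silverman 2005,
§5 Thm. 11 (18) and Rem. 2] [cite: Silverman2005DivPoly, §5 Rem. 2] [cite: MazurTate1991, Thm. 3.1] -/
theorem sigmaSqDivisionIdentity_sq_of_satisfiesSigmaODE [hV : V.IsIntegral ℤ_[p]] [V.IsElliptic]
    {σ : ℚ_[p]⟦X⟧} {c : ℚ_[p]} (hσ0 : constantCoeff σ = 0) (hσ1 : coeff 1 σ = 1)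
    (hodd : V.IsFormallyOdd σ) (hODE : V.SatisfiesSigmaODE σ c) {n : ℕ} (hn : 1 ≤ n) :
    V.SigmaSqDivisionIdentity (σ ^ 2) n := by
  have key : ∀ j : ℕ, V.SigmaSqDivisionIdentity (σ ^ 2) (j + 1) ∧ V.SigmaSqDivisionIdentity (σ ^ 2) (j + 2) := by
    intro j
    induction j with
    | zero => exact ⟨V.sigmaSqDivisionIdentity_one _, sigmaSqDivisionIdentity_sq_two hσ0 hσ1 hodd hODE⟩
    | succ j ih => exact ⟨ih.2, sigmaSqDivisionIdentity_sq_step hσ0 hσ1 hodd hODE j ih.1 ih.2⟩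
  obtain ⟨j, rfl⟩ : ∃ j, n = j + 1 := ⟨n - 1, by omega⟩
  exact (key j).1

end Induction

end WeierstrassCurve
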